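import Literature.NumberTheory.GaloisCohomology.Howard2004.DVRSettingEngineStub
import HarnessLib

/-!
# Howard 2004, Prop. 1.4.1 (Flach's generalised Cassels–Tate pairing) and the display of the proof of
# Thm. 1.4.2, AS INVOKED in §1.6 for `(T^{(k)}, 𝓕(n))`, `n ∈ 𝓝^{(k)}`: the nondegenerate skew pairing
# `( , )_{s,1} : ℋ[𝔪^s]/𝔪ℋ[𝔪^{s+1}] × ℋ[𝔪]/𝔪^sℋ[𝔪^{s+1}] → R[𝔪]` on `ℋ = H¹_{𝓕(n)}(K, T^{(k)})` — ONE cite-only named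
# fact (the candidate input «C45.1′ (CT-SKEW letter)» of the G87 desk, cell `pub/bsd-print-x9`)

Topic `NumberTheory/GaloisCohomology/Howard2004` (literature seat g45; minted on the pre-mint reading rulings REF-160 /
REF-162 of the cell referee, the LEAD preference «C45.1′ ≻ (α)» of `bsd-line-x10b-p1` LEAD g12 (2026-08-29T06:19:28Z) and
the letter HOME `p1/C451-SKEW-LETTER-x9-p1-LEADg9.md` of `bsd-line-x9-p1` LEAD g9; its kernel consumer is
`DVRSetting.exists_addEquiv_package_of_skewPairings_atLevel` (p702772, `CasselsTateSkewPairingAtLevelProofs.lean`) /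
`DVRSetting.conclusion_of_skewPairings` (p702154)).  ONE named fact (`def … : Prop`, D-0014; nothing asserted; debt +1);
no definition, no instance, no notation, no `sorry`.  HONEST FRAMING: typed ≠ proved ≠ endorsed; Flach's pairing and the
skew identity are NOT proved anywhere in the tree; `thm161_dvrKolyvaginBound` is not proved by this file; no summit
statement is proved; BSD is not proved by any of this.

B. Howard, *The Heegner point Kolyvagin system*, Compositio Math. **140** (2004) 1439–1472 [Howard2004HeegnerKolyvagin];
text of record = the author's arXiv posting arXiv:1202.6340v1 (held, `paper:arxiv-1202.6340`; arXiv §2.x = Compositio §1.x,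
cell DOSSIER §67.2), locators `[p00NN:Lnn]`.  M. Flach, *A generalisation of the Cassels–Tate pairing*, J. reine angew.
Math. **412** (1990) 113–127 [Flach1990] (Howard: «Our exposition closely follows that of [Flach]» [p0008 L3]).

## The printed statements, verbatim (arXiv §2.4 = Compositio §1.4 «The Cassels–Tate pairing»)

* **§1.4 standing** [p0008 L6–L12]: «Let `R` be a principal Artinian coefficient ring of length `k` and `T` an object of
  `Mod_{R,G_K}`. Fix a generator `π` of the maximal ideal `𝔪` of `R`. Let `T* = Hom(T, R(1))` and fix a Selmer
  structure `𝓕` on `T`. Let `𝓕*` denote the dual Selmer structure on `T*`. In all that follows we assume that `(T, 𝓕)`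
  and `(T*, 𝓕*)` satisfy hypotheses H.0–H.5.»
* **Proposition 1.4.1** [p0008 L83–L98]: «For positive integers `s` and `t` with `s + t ≤ k` there is a pairing
  `( , )_{s,t} : H¹_𝓕(K, T/𝔪^sT) × H¹_{𝓕*}(K, T*[𝔪^t]) → R` whose kernels on the left and right are the images of
  `H¹_𝓕(K, T/𝔪^{s+t}T) → H¹_𝓕(K, T/𝔪^sT)`, `H¹_{𝓕*}(K, T*[𝔪^{s+t}]) →^{π^s} H¹_{𝓕*}(K, T*[𝔪^t])`. *Proof.* The
  construction of the pairing is above. The computation of the kernels is a straightforward modification of the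
  methods of [Flach].»
* **Theorem 1.4.2** [p0008 L100–L105]: «There is an `R`-module `M` and an integer `ε` such that
  `H¹_𝓕(K,T) ≅ R^ε ⊕ M ⊕ M`.»  **Its proof, the two displayed sentences that this fact records** [p0008 L108–L142]:
  «Abbreviate `ℋ = H¹_𝓕(K,T)`, and for `1 ≤ s < k` define `V_s = ℋ[𝔪^s]/𝔪ℋ[𝔪^{s+1}]`, `W_s = ℋ[𝔪]/𝔪^sℋ[𝔪^{s+1}]`.
  […] Using hypothesis H.4 and Lemma (H.5 application), we may identify `H¹_{𝓕*}(K, T*[𝔪]) ≅ H¹_𝓕(K, T[𝔪]) ≅ ℋ[𝔪]`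
  and `H¹_𝓕(K, T/𝔪^sT) ≅ ℋ[𝔪^s]`. (i) Proposition 1.4.1 therefore gives a nondegenerate pairing of `R/𝔪`-vector
  spaces `( , )_{s,1} : V_s × W_s ≅ ℋ[𝔪^s]/𝔪ℋ[𝔪^{s+1}] × ℋ[𝔪]/𝔪^sℋ[𝔪^{s+1}] → R[𝔪]`. We define a pairing
  `⟨ , ⟩ : V_s × V_s → R[𝔪]` by `⟨a, b⟩ = (a, π^{s-1}b)_{s,1}`. […] (ii) To check that this is alternating we must
  verify `(a, π^{s-1}b)_{s,1} = -(b, π^{s-1}a)_{s,1}`.» (the verification of (ii), [p0008 L142 – p0009 L55], is Flach's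
  cochain construction, the resolution of `T ⊗ T`, the reciprocity law `Σ_v inv_v = 0` and the self-orthogonality of
  `𝓕` under the pairing of H.4 — it stays print).
* **Where print INVOKES this for the objects typed here** (§1.6 = arXiv §2.6 [p0011 L17–L21, L33–L44]): «Throughout
  this subsection `R` is a fixed discrete valuation ring with uniformizing parameter `π`. Let `(T, 𝓕, 𝓛)` be a Selmer
  triple satisfying Hypotheses H.0–H.5 […] `R^{(k)} = R/𝔪^k`, `T^{(k)} = T/𝔪^kT`, `𝓛^{(k)} = 𝓛 ∩ 𝓛_k(T)` […] By
  Remark 1.3.1 the Selmer triple `(T^{(k)}, 𝓕, 𝓛^{(k)})` satisfies hypotheses H.0–H.5, and we may invoke the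
  definitions and results of the preceding section [§1.5, whose ¶1, p0009 L101–L104, fixes «a principal Artinian
  coefficient ring of length `k` and a Selmer triple `(T, 𝓕, 𝓛)` satisfying H.0–H.5 with `𝓛 ⊂ 𝓛_k(T)`», and whose
  Lemma 1.5.1 «The Selmer triple `(T, 𝓕(n), 𝓛(n))` satisfies H.0–H.5 for any `n ∈ 𝓝`» (p0009 L127–L133) and the display
  «By Theorem 1.4.2 and Lemma 1.5.1, for each `n ∈ 𝓝` there is an `R`-module `M(n)` and an integer `ε` such that
  `ℋ(n) ≅ R^ε ⊕ M(n) ⊕ M(n)`» (p0010 L45–L51)]. In particular for `n ∈ 𝓝^{(k)} = 𝓝(𝓛^{(k)})` we have a decomposition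
  `H¹_{𝓕(n)}(K, T^{(k)}) ≅ R^{(k),ε} ⊕ M^{(k)}(n) ⊕ M^{(k)}(n)`.»  — Print thus runs the proof of Thm. 1.4.2, displays
  (i)(ii) included, on `ℋ = H¹_{𝓕(n)}(K, T^{(k)})` over `R^{(k)} = R/𝔪^{e_k}` under the `(T, 𝓕, 𝓛)`-ONLY standing of
  §1.5/§1.6 (cell referee REF-160 RULING 3 / REF-162: «(T,𝓕)-only typing faithful by print's own inference»; the
  §1.4 «and (T*, 𝓕*)» clause is how §1.4 is written, not an extra hypothesis print checks in §1.5–§1.6, where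
  `T* ≅ Tw(T)` and `𝓕* = 𝓕^τ` by H.4 [p0007 L80–L93]).

## Transcription (print-exact where the tree has the vocabulary; WEAKER, never stronger, elsewhere)

* `R` a DVR, `π`, the tower `T^{(k)} = T/𝔪^{e_k}` with its triples `(T^{(k)}, 𝓕, 𝓛)` over `R^{(k)}`, H.0–H.5 levelwise:
  the tree's `DVRSetting` `S` with `S.SatisfiesH` — EXACTLY the binders of `thm161_dvrKolyvaginBound` (lit g30; REF-131/132),
  reused, nothing lighter (REF-162 (4)).  Howard's `R^{(k)}` is principal Artinian of length `e_k` (his `e_k = k`); his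
  `1 ≤ s < k` is `s = t + 1`, `t + 1 < e_k`.
* `n ∈ 𝓝^{(k)} = 𝓝(𝓛 ∩ 𝓛_{e_k}(T))` is the guard `↑n ⊆ S.levelPrimes k` (x10b-p1-w7/w2's «DEC-KEY», `DVRSettingEngineStub`
  §3; REF-162 (3): a weaker guard would assert MORE than print); `n = 1` is `n = ∅` (REF-162 (6)).
* `ℋ = H¹_{𝓕(n)}(K, T^{(k)})` is `(((S.t k).atLevel S.jbar n).cond).selmerGroup` (the tree's `𝓕(n)`-at-level Selmer object,
  = the carrier of the ENGINE's `selmerModuleAt` by `Iff.rfl`); `ℋ[𝔪^j] = ℋ[π^j]` is `ℋ ⊓ ker H¹(π^j •)` with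
  `H¹(r •) = galoisCohomology.scalarMapH1 (S.T.ρ k) (S.T.hlin k) r` (the `R`-action on `H¹(K, T^{(k)})` through
  `R → R^{(k)}`; `𝔪^j ℋ = π^j ℋ`, `R` a DVR).
* `R[𝔪]` (the `𝔪`-torsion of `R^{(k)}`, `= 𝔪^{e_k-1}/𝔪^{e_k}`) is recorded as `R ⧸ 𝔪 = R ⧸ IsLocalRing.maximalIdeal R`: both are
  the simple `R`-module, so «there is a nondegenerate skew pairing with values in `R[𝔪]`» and «… in `R/𝔪`» are the SAME
  assertion (existence is invariant under `R[𝔪] ≃ₗ[R] R/𝔪`) — REF-162's docstring request.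
* Sentence (i), «nondegenerate pairing `( , )_{s,1} : V_s × W_s → R[𝔪]`», with `V_s`, `W_s` the printed quotients: an
  additive pairing `P : ℋ[π^{t+1}] →+ ℋ[π] →+ R/𝔪`, `R`-equivariant in each slot (`hP₁`, `hP₂`; Prop. 1.4.1's pairing is the
  cup product with `R(1)`-coefficients, `R`-bilinear), whose LEFT kernel is EXACTLY `𝔪ℋ[𝔪^{s+1}] = π·ℋ[π^{t+2}]` and whose
  RIGHT kernel is EXACTLY `𝔪^sℋ[𝔪^{s+1}] = π^{t+1}·ℋ[π^{t+2}]` (`hleft`, `hright`: «nondegenerate on `V_s × W_s`» = the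
  kernels of Prop. 1.4.1 at `(s, t) = (s, 1)` read through the two printed identifications — the image of
  `H¹_𝓕(K, T/𝔪^{s+1}) → H¹_𝓕(K, T/𝔪^s)` is `πℋ[𝔪^{s+1}] ⊆ ℋ[𝔪^s]`, the image of `π^s : H¹_{𝓕*}(K, T*[𝔪^{s+1}]) →
  H¹_{𝓕*}(K, T*[𝔪])` is `π^sℋ[𝔪^{s+1}] ⊆ ℋ[𝔪]`).
* Sentence (ii), «`(a, π^{s-1}b)_{s,1} = -(b, π^{s-1}a)_{s,1}`» for `a, b ∈ ℋ[𝔪^s]`: `P a (π^t b) = - P b (π^t a)` (`hskew`,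
  with the images `π^t a, π^t b ∈ ℋ[π]` named by equations, as in the consumer).
* The five clauses are, token for token, the hypotheses `(P t, hP₁ t, hP₂ t, hright t, hskew t)` of
  `DVRSetting.exists_addEquiv_package_of_skewPairings_atLevel` at the value modules `Q t := R ⧸ 𝔪` (whose `π`-torsion is
  cyclic: `R/𝔪` is simple) plus the LEFT-kernel clause (printed in sentence (i); not read by that consumer).  Everything
  print derives AFTER (i)(ii) — «`⟨ , ⟩` alternating», «the kernel on the right is `V_{s-1}`», «`V_s/V_{s-1}` even
  dimensional», the structure theorem, Prop. 1.5.5's count, Thm. 1.6.1 — is KERNEL in this tree (p702154 / p702772 /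
  `PairedTorsionModules*` / p690450), not part of the fact.
* R2-G44 audit: printed hypotheses of the invoked statement = {`R` principal Artinian coefficient ring of length `e_k` with
  generator `π` of `𝔪`; `(T^{(k)}, 𝓕(n))` satisfies H.0–H.5 (via Rem. 1.3.1 + Lemma 1.5.1 from `(T, 𝓕, 𝓛)` with H.0–H.5,
  `n ∈ 𝓝^{(k)}`); `1 ≤ s < e_k`} — all present (`S`, `hy : S.SatisfiesH`, `hn`, `ht`); the §1.4 clause «and `(T*, 𝓕*)`» is
  NOT a separate binder, by the REF-160/REF-162 reading recorded above (print's own §1.5/§1.6 usage); NO «`Σ(𝓕)`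
  `σ`-stable» binder (LEAD g12 withdrew it, REF-162 (2)); nothing else added.
* PROVENANCE (annotation): Prop. 1.4.1's kernels are printed as «a straightforward modification of the methods of
  [Flach]» — token `How04-1.4.1@Flach1990-modification`; not a reliability reservation.
NOT typed (D-0026; no consumer): Prop. 1.4.1 in its own two-module form `H¹_𝓕(K,T/𝔪^sT) × H¹_{𝓕*}(K,T*[𝔪^t]) → R` for
general `(s, t)`; Thm. 1.4.2 as a separate fact (it is now a kernel consequence of this one, p702154); Prop. 1.5.5.

References: [Howard2004HeegnerKolyvagin] §1.4 (standing, Prop. 1.4.1, Thm. 1.4.2 and its proof: arXiv:1202.6340 p0008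
L1–L142, p0009 L1–L55), §1.5 ¶1 and Lemma 1.5.1 (p0009 L101–L133), §1.6 ¶1–¶3 (p0011 L17–L48), Rem. 1.3.1 (p0007
L125–L127); [Flach1990] (the pairing and its kernels).
-/

noncomputable section

open Function NumberField IsDedekindDomain Field Module Submodule
open scoped NumberField ContRepresentation Pointwise

namespace Literature.NumberTheory.GaloisCohomology.Howard2004

open Literature.NumberTheory.GaloisRepresentations
open Literature.NumberTheory.GaloisRepresentations.DiscreteGaloisModule

/-- **Howard 2004, Prop. 1.4.1 (after Flach 1990) with the two displayed sentences of the proof of Thm. 1.4.2**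
(Compositio Math. 140, p. 1449 = arXiv:1202.6340 Prop. 2.4.1 / Thm. 2.4.2, p0008 L83–L142), **as invoked in §1.6 ¶3
(p0011 L40–L44) for `ℋ = H¹_{𝓕(n)}(K, T^{(k)})` over `R^{(k)} = R/𝔪^{e_k}`, `n ∈ 𝓝^{(k)}`**, verbatim: (i) «Proposition
1.4.1 therefore gives a nondegenerate pairing of `R/𝔪`-vector spaces
`( , )_{s,1} : V_s × W_s ≅ ℋ[𝔪^s]/𝔪ℋ[𝔪^{s+1}] × ℋ[𝔪]/𝔪^sℋ[𝔪^{s+1}] → R[𝔪]`» (`1 ≤ s < e_k`) and (ii) «`(a, π^{s-1}b)_{s,1}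
= -(b, π^{s-1}a)_{s,1}`» — CITE-ONLY.  RECORDED AS: for every `DVRSetting` `S` with `S.SatisfiesH` (H.0–H.5; the binders of
`thm161_dvrKolyvaginBound`), every level `k`, every finite set of primes `n` with `↑n ⊆ S.levelPrimes k` (`n ∈ 𝓝^{(k)} =
𝓝(𝓛 ∩ 𝓛_{e_k}(T))`) and every `t` with `t + 1 < e_k` (`s = t + 1`), writing `ℋ = (((S.t k).atLevel S.jbar n).cond).selmerGroup`
and `ℋ[π^j] = ℋ ⊓ ker H¹(π^j •)`: THERE IS an additive pairing `P : ℋ[π^{t+1}] → ℋ[π] → R/𝔪` (values in the simple module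
`R/𝔪 ≅ R[𝔪]`, so the assertion is the printed one), `R`-equivariant in both slots, with LEFT kernel exactly `π·ℋ[π^{t+2}]`
and RIGHT kernel exactly `π^{t+1}·ℋ[π^{t+2}]` («nondegenerate on `V_s × W_s`»), and skew: `P a (π^t b) = - P b (π^t a)`.
These are, token for token, the hypotheses `(P t, hP₁ t, hP₂ t, hright t, hskew t)` of
`DVRSetting.exists_addEquiv_package_of_skewPairings_atLevel` at `Q t := R ⧸ 𝔪` (+ the printed LEFT-kernel clause).  The
§1.4 standing «`(T, 𝓕)` and `(T*, 𝓕*)` satisfy H.0–H.5» is carried by `S.SatisfiesH` under print's own §1.5/§1.6 usage (module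
docstring; cell REF-160/REF-162); NO `Σ(𝓕)`-stability binder.  PUBLISHED (Compositio 2004).  The verification of (ii)
(Flach's cochains, the `C ⊗ C` resolution and the reciprocity law `Σ_v inv_v = 0`, arXiv p0008 L142 – p0009 L55) and the
computation of the kernels in Prop. 1.4.1 («a straightforward modification of the methods of [Flach]») stay PRINT: this
is a cite-only `def … : Prop`, no `_holds`.  A `Prop`; nothing asserted.
[cite: Howard2004HeegnerKolyvagin, Prop. 1.4.1 and Thm. 1.4.2 (proof, displays (i)(ii)) (arXiv:1202.6340 p0008 L83–L142, p0009 L1–L55), invoked for (T^{(k)}, 𝓕(n)), n ∈ 𝓝^{(k)}, in §1.6 ¶3 (p0011 L33–L44) via Rem. 1.3.1 and Lemma 1.5.1 (p0009 L101–L133)]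
[cite: Flach1990, the generalised Cassels–Tate pairing and its kernels (J. reine angew. Math. 412, 113–127)] -/
def prop141_casselsTate_skewPairing_atLevel : Prop :=
  ∀ (p : ℕ) [Fact p.Prime] (K : Type) [Field K] [NumberField K]
    (R : Type) [CommRing R] [IsDomain R] [IsDiscreteValuationRing R] [Algebra ℤ_[p] R]
    (N : ℕ → Type) [∀ k, AddCommGroup (N k)] [∀ k, TopologicalSpace (N k)]
    [∀ k, DiscreteTopology (N k)] [∀ k, Module R (N k)]
    (Rk : ℕ → Type) [∀ k, CommRing (Rk k)] [∀ k, IsLocalRing (Rk k)] [∀ k, TopologicalSpace (Rk k)]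
    [∀ k, DiscreteTopology (Rk k)] [∀ k, Algebra ℤ_[p] (Rk k)] [∀ k, Algebra R (Rk k)]
    [∀ k, Module (Rk k) (N k)] [∀ k, IsScalarTower R (Rk k) (N k)]
    (Nbar : Type) [AddCommGroup Nbar] [TopologicalSpace Nbar] [DiscreteTopology Nbar]
    [∀ k, Module (Rk k) Nbar]
    (Nq : ℕ → Finset (HeightOneSpectrum (𝓞 K)) → Type) [∀ k n, AddCommGroup (Nq k n)]
    [∀ k n, TopologicalSpace (Nq k n)] [∀ k n, DiscreteTopology (Nq k n)]
    [∀ k n, Module (Rk k) (Nq k n)] [∀ k n, Module R (Nq k n)]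
    [∀ k n, IsScalarTower R (Rk k) (Nq k n)]
    (S : DVRSetting p K R N Rk Nbar Nq), S.SatisfiesH →
    ∀ (k : ℕ) (n : Finset (HeightOneSpectrum (𝓞 K))), ↑n ⊆ S.levelPrimes k →
    ∀ (t : ℕ), t + 1 < S.e k →
    ∃ P : ↥((((S.t k).atLevel S.jbar n).cond).selmerGroup ⊓
        (galoisCohomology.scalarMapH1 (S.T.ρ k) (S.T.hlin k) (S.π ^ (t + 1))).ker) →+
      ↥((((S.t k).atLevel S.jbar n).cond).selmerGroup ⊓
        (galoisCohomology.scalarMapH1 (S.T.ρ k) (S.T.hlin k) S.π).ker) →+ (R ⧸ IsLocalRing.maximalIdeal R),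
      -- `R`-equivariance in the first slot («pairing of `R/𝔪`-vector spaces»)
      (∀ (r : R) (x x' : ↥((((S.t k).atLevel S.jbar n).cond).selmerGroup ⊓
          (galoisCohomology.scalarMapH1 (S.T.ρ k) (S.T.hlin k) (S.π ^ (t + 1))).ker))
          (w : ↥((((S.t k).atLevel S.jbar n).cond).selmerGroup ⊓
            (galoisCohomology.scalarMapH1 (S.T.ρ k) (S.T.hlin k) S.π).ker)),
        (x' : galoisCohomology (S.T.ρ k) 1) =
          galoisCohomology.scalarMapH1 (S.T.ρ k) (S.T.hlin k) r (x : galoisCohomology (S.T.ρ k) 1) →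
        P x' w = r • P x w) ∧
      -- `R`-equivariance in the second slot
      (∀ (r : R) (x : ↥((((S.t k).atLevel S.jbar n).cond).selmerGroup ⊓
          (galoisCohomology.scalarMapH1 (S.T.ρ k) (S.T.hlin k) (S.π ^ (t + 1))).ker))
          (w w' : ↥((((S.t k).atLevel S.jbar n).cond).selmerGroup ⊓
            (galoisCohomology.scalarMapH1 (S.T.ρ k) (S.T.hlin k) S.π).ker)),
        (w' : galoisCohomology (S.T.ρ k) 1) =
          galoisCohomology.scalarMapH1 (S.T.ρ k) (S.T.hlin k) r (w : galoisCohomology (S.T.ρ k) 1) →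
        P x w' = r • P x w) ∧
      -- nondegenerate on `V_s = ℋ[𝔪^s]/𝔪ℋ[𝔪^{s+1}]`: the LEFT kernel is exactly `π·ℋ[π^{t+2}]`
      (∀ x : ↥((((S.t k).atLevel S.jbar n).cond).selmerGroup ⊓
          (galoisCohomology.scalarMapH1 (S.T.ρ k) (S.T.hlin k) (S.π ^ (t + 1))).ker),
        (∀ w, P x w = 0) ↔
          ∃ z ∈ (((S.t k).atLevel S.jbar n).cond).selmerGroup,
            galoisCohomology.scalarMapH1 (S.T.ρ k) (S.T.hlin k) (S.π ^ (t + 2)) z = 0 ∧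
            (x : galoisCohomology (S.T.ρ k) 1) = galoisCohomology.scalarMapH1 (S.T.ρ k) (S.T.hlin k) S.π z) ∧
      -- nondegenerate on `W_s = ℋ[𝔪]/𝔪^sℋ[𝔪^{s+1}]`: the RIGHT kernel is exactly `π^{t+1}·ℋ[π^{t+2}]`
      (∀ w : ↥((((S.t k).atLevel S.jbar n).cond).selmerGroup ⊓
          (galoisCohomology.scalarMapH1 (S.T.ρ k) (S.T.hlin k) S.π).ker),
        (∀ x, P x w = 0) ↔
          ∃ z ∈ (((S.t k).atLevel S.jbar n).cond).selmerGroup,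
            galoisCohomology.scalarMapH1 (S.T.ρ k) (S.T.hlin k) (S.π ^ (t + 2)) z = 0 ∧
            (w : galoisCohomology (S.T.ρ k) 1) =
              galoisCohomology.scalarMapH1 (S.T.ρ k) (S.T.hlin k) (S.π ^ (t + 1)) z) ∧
      -- skew-symmetry «(a, π^{s-1}b)_{s,1} = -(b, π^{s-1}a)_{s,1}»
      (∀ (a b : ↥((((S.t k).atLevel S.jbar n).cond).selmerGroup ⊓
          (galoisCohomology.scalarMapH1 (S.T.ρ k) (S.T.hlin k) (S.π ^ (t + 1))).ker))
          (a' b' : ↥((((S.t k).atLevel S.jbar n).cond).selmerGroup ⊓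
            (galoisCohomology.scalarMapH1 (S.T.ρ k) (S.T.hlin k) S.π).ker)),
        (a' : galoisCohomology (S.T.ρ k) 1) =
          galoisCohomology.scalarMapH1 (S.T.ρ k) (S.T.hlin k) (S.π ^ t) (a : galoisCohomology (S.T.ρ k) 1) →
        (b' : galoisCohomology (S.T.ρ k) 1) =
          galoisCohomology.scalarMapH1 (S.T.ρ k) (S.T.hlin k) (S.π ^ t) (b : galoisCohomology (S.T.ρ k) 1) →
        P a b' = - P b a')

end Literature.NumberTheory.GaloisCohomology.Howard2004

end
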